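import Literature.Probability.LatticeModels.LatticeLaplacianZd
import HarnessLib

/-!
# Crux `PositiveSolutionAsymptotics` (stmt-CriticalPhenomena-4496), stub H1: Green's second identity

THEOREM-ONLY file (no definitions, no named facts), `--supports stmt-CriticalPhenomena-4496`.
`stub_greenIdentity` is stub H1 of the registered skeleton of crux
`…Theses.InverseSquareTelemetry.PositiveSolutionAsymptotics`: **Green's second identity** for the
graph Laplacian `Δ = latticeLaplacianZd` of `ℤ^d` on a finite set `D ⊆ ℤ^d`,

  `Σ_{x ∈ D} (f Δg - g Δf)(x) = Σ_{x ∈ D} Σᵢ Σ_{y = x ± eᵢ ∉ D} (f(x) g(y) - g(x) f(y))`.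

Proof: `(f Δg - g Δf)(x) = Σᵢ (A(x, x+eᵢ) + A(x, x-eᵢ))` with the antisymmetric
`A(x, y) = f(x) g(y) - g(x) f(y)` (the diagonal `2d`-terms cancel); after `Finset.sum_comm` the
contributions of the edges `{x, x ± eᵢ}` with both ends in `D` cancel in pairs
(`sum_ite_edge_cancel`, a double sum over `D × D` and `A(x,y) + A(y,x) = 0`), and what is left is the
boundary sum on the right.
-/
noncomputable section

namespace Summit.CriticalPhenomena.Ising3DConformalLimit.Theorems.PositiveSolutionAsymptotics

open Literature.Probability.LatticeModels Finset

/-- **Cancellation of the interior edges.** For an antisymmetric kernel `A` (`A x y + A y x = 0`),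
a finite set `D` in an additive commutative group and a step `e`,
`Σ_{x ∈ D} (𝟙[x+e ∈ D] A(x, x+e) + 𝟙[x-e ∈ D] A(x, x-e)) = 0`: writing both indicator terms as
double sums over `D × D` and swapping the second, the summand becomes
`𝟙[x + e = y] (A(x,y) + A(y,x)) = 0`. [folklore] -/
theorem sum_ite_edge_cancel {V : Type*} [AddCommGroup V] [DecidableEq V] (D : Finset V)
    (A : V → V → ℝ) (hA : ∀ x y, A x y + A y x = 0) (e : V) :
    ∑ x ∈ D, ((if x + e ∈ D then A x (x + e) else 0) + (if x - e ∈ D then A x (x - e) else 0)) =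
      0 := by
  have h1 : ∀ x, (if x + e ∈ D then A x (x + e) else 0) = ∑ y ∈ D, if x + e = y then A x y else 0 :=
    fun x => (Finset.sum_ite_eq D (x + e) (A x)).symm
  have h2 : ∀ x, (if x - e ∈ D then A x (x - e) else 0) = ∑ y ∈ D, if x - e = y then A x y else 0 :=
    fun x => (Finset.sum_ite_eq D (x - e) (A x)).symm
  simp_rw [Finset.sum_add_distrib, h1, h2]
  rw [Finset.sum_comm (f := fun x y => if x - e = y then A x y else 0), ← Finset.sum_add_distrib]
  refine Finset.sum_eq_zero fun x _ => ?_
  rw [← Finset.sum_add_distrib]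
  refine Finset.sum_eq_zero fun y _ => ?_
  have hiff : y - e = x ↔ x + e = y := by rw [sub_eq_iff_eq_add, eq_comm]
  by_cases hxy : x + e = y
  · rw [if_pos hxy, if_pos (hiff.mpr hxy)]
    exact hA x y
  · rw [if_neg hxy, if_neg fun h => hxy (hiff.mp h), add_zero]

/-- **Green's second identity on one lattice direction.** For an antisymmetric kernel `A`, a finite
set `D` and a step `e`,
`Σ_{x∈D} (A(x,x+e) + A(x,x-e)) = Σ_{x∈D} (𝟙[x+e ∉ D] A(x,x+e) + 𝟙[x-e ∉ D] A(x,x-e))`: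
split each term according to whether the neighbour lies in `D`; the interior part vanishes by
`sum_ite_edge_cancel`. [folklore] -/
theorem sum_edge_eq_sum_boundary {V : Type*} [AddCommGroup V] [DecidableEq V] (D : Finset V)
    (A : V → V → ℝ) (hA : ∀ x y, A x y + A y x = 0) (e : V) :
    ∑ x ∈ D, (A x (x + e) + A x (x - e)) =
      ∑ x ∈ D, ((if x + e ∈ D then 0 else A x (x + e)) + (if x - e ∈ D then 0 else A x (x - e))) := by
  calc ∑ x ∈ D, (A x (x + e) + A x (x - e))
      = ∑ x ∈ D, ((if x + e ∈ D then A x (x + e) else 0) + (if x - e ∈ D then A x (x - e) else 0)) +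
          ∑ x ∈ D, ((if x + e ∈ D then 0 else A x (x + e)) +
            (if x - e ∈ D then 0 else A x (x - e))) := by
        rw [← Finset.sum_add_distrib]
        refine Finset.sum_congr rfl fun x _ => ?_
        by_cases hp : x + e ∈ D <;> by_cases hm : x - e ∈ D <;> simp only [hp, hm, if_true, if_false] <;>
          ring
    _ = _ := by rw [sum_ite_edge_cancel D A hA e, zero_add]

/-- **H1 (Green's second identity on a finite subset of `ℤ^d`).** For every finite `D ⊆ ℤ^d` and
`f g : ℤ^d → ℝ`, `Σ_{x∈D} (f Δg - g Δf)(x)` equals the sum over the lattice edges leaving `D` of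
`f(x) g(y) - g(x) f(y)` (`x ∈ D`, `y = x ± eᵢ ∉ D`): the contributions of the edges inside `D` cancel by
antisymmetry (`Finset.sum_comm`, `sum_edge_eq_sum_boundary`). [folklore] -/
theorem stub_greenIdentity :
    ∀ (d : ℕ) (D : Finset (Literature.Probability.LatticeModels.Site d)) (f g : Literature.Probability.LatticeModels.Site d → ℝ),
      ∑ x ∈ D, (f x * Literature.Probability.LatticeModels.latticeLaplacianZd g x - g x * Literature.Probability.LatticeModels.latticeLaplacianZd f x) =
      ∑ x ∈ D, ∑ i : Fin d, ((if x + Pi.single i 1 ∈ D then (0 : ℝ) else (f x * g (x + Pi.single i 1) - g x * f (x + Pi.single i 1))) + (if x - Pi.single i 1 ∈ D then (0 : ℝ) else (f x * g (x - Pi.single i 1) - g x * f (x - Pi.single i 1)))) := by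
  intro d D f g
  -- the antisymmetric edge kernel
  set A : Site d → Site d → ℝ := fun x y => f x * g y - g x * f y with hA
  have hanti : ∀ x y, A x y + A y x = 0 := fun x y => by
    simp only [hA]
    ring
  -- pointwise: `f Δg - g Δf = Σᵢ (A(x, x+eᵢ) + A(x, x-eᵢ))` (the `2d`-terms cancel)
  have hpt : ∀ x : Site d, f x * latticeLaplacianZd g x - g x * latticeLaplacianZd f x =
      ∑ i : Fin d, (A x (x + Pi.single i 1) + A x (x - Pi.single i 1)) := by
    intro x
    simp only [hA, latticeLaplacianZd_def, mul_sub, mul_add, Finset.mul_sum, Finset.sum_add_distrib,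
      Finset.sum_sub_distrib]
    ring
  calc ∑ x ∈ D, (f x * latticeLaplacianZd g x - g x * latticeLaplacianZd f x)
      = ∑ x ∈ D, ∑ i : Fin d, (A x (x + Pi.single i 1) + A x (x - Pi.single i 1)) :=
        Finset.sum_congr rfl fun x _ => hpt x
    _ = ∑ i : Fin d, ∑ x ∈ D, (A x (x + Pi.single i 1) + A x (x - Pi.single i 1)) := Finset.sum_comm
    _ = ∑ i : Fin d, ∑ x ∈ D, ((if x + Pi.single i 1 ∈ D then (0 : ℝ) else A x (x + Pi.single i 1)) +
          (if x - Pi.single i 1 ∈ D then (0 : ℝ) else A x (x - Pi.single i 1))) :=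
        Finset.sum_congr rfl fun i _ => sum_edge_eq_sum_boundary D A hanti (Pi.single i 1)
    _ = _ := Finset.sum_comm

end Summit.CriticalPhenomena.Ising3DConformalLimit.Theorems.PositiveSolutionAsymptotics
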